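import Summits.ValiantsHypothesis.ValiantsHypothesis.Theorems.KPlusLogSqLawDiagonalDesign
import Summits.ValiantsHypothesis.ValiantsHypothesis.Theorems.LacunarySymmetroidMatrixDescartesCensusSpanTwoSector
import Summits.ValiantsHypothesis.ValiantsHypothesis.Theorems.LacunarySymmetroidMatrixDescartesStubCommutingSector
import Summits.ValiantsHypothesis.ValiantsHypothesis.Theorems.LacunarySymmetroidMatrixDescartesStubNegRoots

/-!
# Route «KPlusLogSqLaw» — `Lifting` VERBATIM on two PENCIL SECTORS, all formats: commuting (symmetric, pairwise commuting
# coefficients) and span-two (coefficients in a 2-dimensional span), constant `C = 2` (toward crux `Lifting`, stmt-ValiantsHypothesis-19772)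

HONEST FRAMING.  Object-search cell `pub-symmetroid`, Conjecture-B route `KPlusLogSqLaw`.  The crux `Lifting` — «a tropical row bound `n`
at format `(m, K)` gives the real row bound `2^{CK}·(n+1)` for EVERY real symmetric pencil of that format» — is an OPEN conjecture and is
NOT claimed.  This file proves its inequality VERBATIM, with `C = 2` and for ALL `(m, K, n)` (no Descartes-zone restriction on the format),
for two CLASSES OF PENCILS on which the cell owns a sub-Descartes real bound: the COMMUTING sector (`stub_commutingSector`: `Z₊ ≤ m(K−1)`)
and the SPAN-TWO sector (`Census.card_roots_spanTwo`: `Z ≤ 2(m+1)(K−1) + 1`).  The tropical input is this seat's census floor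
`DiagK.le_of_tropRootLawAt` (`TropRootLawAt m K n → m(K−1) ≤ n`), so on these sectors both sides are linear in `m(K−1)` and the inequality
`Z ≤ 4·(n+1) ≤ 2^{2K}(n+1)` follows.  This is a SECTOR rung in the sense of the route's `TropicalB` Hessenberg rung (restriction on the object,
not on the format); it says nothing about `Lifting` for general pencils, where the real row is Descartes-size (`C(m+K−1,m) − 1`) and the question
is the one located in HOME/val-sym-lift-p4/GAP-LIFT.md.  Nothing here bears on `TropicalB`, `KPlusLogSqLaw`, `MatrixDescartes`, a Door-A numeral
or `VP ≠ VNP`.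

CONTENTS (all proved): `sector_arith` (the arithmetic `2a(K−1)+1 ≤ 2^{2K}(n+1)` from `m(K−1) ≤ n`, `a ≤ m+1`, with the corners `K ≤ 1`,
`m = 0`); `lifting_commutingSector`; `lifting_spanTwoSector`. [folklore]
-/

-- `Summit.ValiantsHypothesis.ValiantsHypothesis.…` repeats a component by the D-0017 layout
-- (single-conjunct summit), which the `dupNamespace` linter flags; the name is mandated.
set_option linter.dupNamespace false
set_option autoImplicit false

namespace Summit.ValiantsHypothesis.ValiantsHypothesis.Theorems.LacunarySymmetroidMatrixDescartes.TropicalCensus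

open Summit.ValiantsHypothesis.ValiantsHypothesis.Theorems.LacunarySymmetroidMatrixDescartes
open scoped BigOperators
open Polynomial

/-- the sector arithmetic: if `K ≥ 2 → m ≥ 1 → m(K−1) ≤ n` (the tropical floor when it applies) and `a ≤ m + 1`, then
`2·(a(K−1)) + 1 ≤ 2^{2K}·(n+1)`. [folklore] -/
theorem sector_arith {m K n a : ℕ} (ha : a ≤ m + 1) (hfloor : 2 ≤ K → 1 ≤ m → m * (K - 1) ≤ n) :
    2 * (a * (K - 1)) + 1 ≤ 2 ^ (2 * K) * (n + 1) := by
  have h4 : ∀ {K : ℕ}, 2 ≤ K → 4 ≤ 2 ^ (2 * K) := fun {K} hK =>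
    calc 4 = 2 ^ (2 * 1) := by norm_num
      _ ≤ 2 ^ (2 * K) := Nat.pow_le_pow_right (by norm_num) (by omega)
  rcases Nat.lt_or_ge K 2 with hK | hK
  · -- K ≤ 1: no zero budget needed beyond 1
    have h0 : a * (K - 1) = 0 := by
      rw [show K - 1 = 0 by omega, Nat.mul_zero]
    rw [h0]
    have : 1 ≤ 2 ^ (2 * K) * (n + 1) := Nat.one_le_iff_ne_zero.mpr (Nat.mul_ne_zero (by positivity) (by omega))
    omega
  · rcases Nat.eq_zero_or_pos m with hm | hm
    · -- m = 0: a ≤ 1, and 2(K−1)+1 ≤ 4^K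
      subst hm
      have ha1 : a * (K - 1) ≤ K - 1 := by
        calc a * (K - 1) ≤ 1 * (K - 1) := Nat.mul_le_mul_right _ (by omega)
          _ = K - 1 := Nat.one_mul _
      have hK4 : 2 * (K - 1) + 1 ≤ 2 ^ (2 * K) := by
        have h2K : K < 2 ^ K := Nat.lt_two_pow_self
        have h2K' : K - 1 < 2 ^ K := by omega
        have hsq : 2 ^ (2 * K) = 2 ^ K * 2 ^ K := by rw [two_mul, pow_add]
        have h2 : 2 ≤ 2 ^ K := by
          calc 2 = 2 ^ 1 := by norm_num
            _ ≤ 2 ^ K := Nat.pow_le_pow_right (by norm_num) (by omega)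
        rw [hsq]
        calc 2 * (K - 1) + 1 ≤ 2 * (K - 1) + 2 := by omega
          _ = 2 * (K - 1 + 1) := by ring
          _ ≤ 2 ^ K * (K - 1 + 1) := Nat.mul_le_mul_right _ h2
          _ ≤ 2 ^ K * 2 ^ K := Nat.mul_le_mul_left _ (by omega)
      calc 2 * (a * (K - 1)) + 1 ≤ 2 * (K - 1) + 1 := by omega
        _ ≤ 2 ^ (2 * K) := hK4
        _ ≤ 2 ^ (2 * K) * (n + 1) := Nat.le_mul_of_pos_right _ (Nat.succ_pos n)
    · have hn : m * (K - 1) ≤ n := hfloor hK hm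
      have h1 : a * (K - 1) ≤ (m + 1) * (K - 1) := Nat.mul_le_mul_right _ ha
      have h2 : (m + 1) * (K - 1) = m * (K - 1) + (K - 1) := by ring
      have h3 : K - 1 ≤ m * (K - 1) := Nat.le_mul_of_pos_left _ hm
      calc 2 * (a * (K - 1)) + 1 ≤ 4 * (m * (K - 1) + 1) := by omega
        _ ≤ 2 ^ (2 * K) * (n + 1) := Nat.mul_le_mul (h4 hK) (by omega)

/-- **`Lifting` verbatim on the COMMUTING sector** (`C = 2`, every format): if the tropical row `(m,K)` is at most `n`, then every real
symmetric `K`-term `m × m` lacunary pencil whose coefficients pairwise commute has at most `2^{2K}·(n+1)` distinct real zeros of its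
determinant.  Ingredients: `stub_commutingSector` for the pencil and its reflection (`Z₊ ≤ m(K−1)` each), `stub_negRoots`, and the census
floor `DiagK.le_of_tropRootLawAt`. [folklore] -/
theorem lifting_commutingSector (m K n : ℕ) (hT : TropRootLawAt m K n) (d : Fin K → ℕ)
    (S : Fin K → Matrix (Fin m) (Fin m) ℝ) (hS : ∀ l, (S l).IsSymm) (hcomm : ∀ l l', S l * S l' = S l' * S l) :
    (Matrix.det (∑ l, ((X : ℝ[X]) ^ d l) • (S l).map C)).roots.toFinset.card ≤ 2 ^ (2 * K) * (n + 1) := by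
  have h1 := stub_commutingSector K m d S hS hcomm
  have h2 := stub_commutingSector K m d (fun l => ((-1 : ℝ) ^ d l) • S l) (fun l => (hS l).smul _)
    (fun l l' => by rw [Matrix.smul_mul, Matrix.mul_smul, Matrix.smul_mul, Matrix.mul_smul, hcomm, smul_comm])
  have h3 := stub_negRoots K m d S
  have h4 : 2 * (m * (K - 1)) + 1 ≤ 2 ^ (2 * K) * (n + 1) :=
    sector_arith (Nat.le_succ m) fun hK _ => DiagK.le_of_tropRootLawAt m K hK hT
  omega

/-- **`Lifting` verbatim on the SPAN-TWO sector** (`C = 2`, every format): if the tropical row `(m,K)` is at most `n`, then every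
`K`-term `m × m` lacunary pencil whose coefficients lie in the span of two matrices `A`, `B` (symmetric or not) has at most `2^{2K}·(n+1)`
distinct real zeros of its determinant.  Ingredients: `Census.card_roots_spanTwo` (`Z ≤ 2(m+1)(K−1) + 1`) and the census floor. [folklore] -/
theorem lifting_spanTwoSector (m K n : ℕ) (hT : TropRootLawAt m K n) (d : Fin K → ℕ) (A B : Matrix (Fin m) (Fin m) ℝ)
    (α β : Fin K → ℝ) :
    (Matrix.det (∑ l, ((X : ℝ[X]) ^ d l) • (α l • A + β l • B).map C)).roots.toFinset.card ≤ 2 ^ (2 * K) * (n + 1) := by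
  have h1 := Census.card_roots_spanTwo d A B α β
  have h4 : 2 * ((m + 1) * (K - 1)) + 1 ≤ 2 ^ (2 * K) * (n + 1) :=
    sector_arith le_rfl fun hK _ => DiagK.le_of_tropRootLawAt m K hK hT
  omega

end Summit.ValiantsHypothesis.ValiantsHypothesis.Theorems.LacunarySymmetroidMatrixDescartes.TropicalCensus
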